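import Summits.NavierStokesRegularity.FluidComputer.PalasekTowerBurgersLayerSheetUniform

/-!
# The Burgers-LAYER read-out is ROBUST: a slice near a translated layer inherits the level-1 readouts

Cell `ns-blowup`, seat `ns-blowup-ecbridge-4` (g6; D-0074 GROUP C «BRIDGE SUPPORT», stub `first_episode` of
the crux `EpisodeBase` = item stmt-NavierStokesRegularity-19179 of the route `PalasekTowerBreakdown`, line
`slot`; supports / evidence only, nothing claimed). The files `PalasekTowerBurgersLayerReadout(Floors).lean`
prove the first lemma `LayerReadoutWide` of the crux idea «orthogonal-seed-contact-strain» (19179 evidence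
#47/#48): the exact Burgers vortex layer `readout = burgersLayer 260000 1 6400` meets the four level-1
readouts of the rigid wide register (at the origin). A certified or designed slice `v = u(τ₁, ·)` is never
EXACTLY a Burgers layer; what a certificate can deliver is CLOSENESS to a translated layer
`x ↦ readout (x − c)` near a centre `c` in the tower's ball. This file turns closeness into the register's
clauses, with explicit margins read off the certified numbers (`‖readout(1/120,0,0)‖ ≥ 3040`,
`‖D readout(0)‖ ≥ 1299830`, `‖readout‖ ≤ 4562` on the slab, circulation `≥ 13.5` on the loop of speed
`2π/N₁ ≤ 0.01413`, against `Y₁ < 2779`, `A₁ < 1238361`, `(5/3)Y₁ > 4630`, `N₁^{β−2} < 6.234`):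

* §1 perturbation tools (generic): translating a loop does not change circulation
  (`circulation_translate`), and **circulation is stable under sup-perturbation on the loop**:
  `circulation u γ − εL ≤ circulation v γ` when `‖v − u‖ ≤ ε` along `γ` and `‖γ′‖ ≤ L`
  (`circulation_sub_le_of_near`; `u, v` continuous, `γ ∈ C¹`);
* §2 the level-1 clauses for ANY slice `v` and centre `c`: velocity floor if
  `‖v(c + x⋆) − readout x⋆‖ ≤ 261` (`x⋆ = (1/120, 0, 0)`); strain floor if
  `‖Dv(c) − D readout(0)‖ ≤ 61000`; ceiling `(5/3)Y₁` at `c + x` for `x` in the slab if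
  `‖v(c + x) − readout x‖ ≤ 68`; core ledger (the `j = 1` clause of `CoreLedger`, loop `c + γ_{1/N₁}`)
  if `v` is continuous and `‖v(c + γ(s)) − readout(γ(s))‖ ≤ 500` along the loop; bundled as
  `OrthogonalSeed.clauses_of_near` on every rigid wide schedule with `‖c‖ + 1/120 ≤ radius`.

LABEL: MODEL-side register arithmetic (perturbative form). WHAT THIS IS NOT: not Navier–Stokes evidence —
no slice of any flow is shown to be near the layer; nothing about any registered stage, the card's host,
`FirstEpisodeD`, `RungG 1`, `EpisodeBaseG` or blow-up. References: J. M. Burgers, Adv. Appl. Mech. 1 (1948)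
171–199; S. Palasek, arXiv:2605.13827 §3–§4 [cite: Palasek2026ElementaryModel, §4]. [folklore] calculus.
-/

noncomputable section

namespace Summit.NavierStokesRegularity.FluidComputer.PalasekTowerClayBridge

open Set MeasureTheory Filter Topology Function Real intervalIntegral
open scoped ContDiff RealInnerProductSpace
open Literature.Analysis.FluidPDE

/-! ## §1 Perturbation tools -/

/-- **Translating a loop does not change the circulation read-out**: the circulation of `v` around
`s ↦ c + γ(s)` is the circulation of `v(c + ·)` around `γ`. [folklore] -/
theorem circulation_translate (v : EuclideanSpace ℝ (Fin 3) → EuclideanSpace ℝ (Fin 3))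
    (c : EuclideanSpace ℝ (Fin 3)) (γ : ℝ → EuclideanSpace ℝ (Fin 3)) :
    circulation v (fun s => c + γ s) = circulation (fun y => v (c + y)) γ := by
  unfold circulation
  congr 1
  funext s
  rw [deriv_const_add]

/-- **Circulation is stable under sup-perturbation on the loop**: if `u, v` are continuous, `γ` is `C¹`
with `‖γ′‖ ≤ L` on `[0, 1]`, and `‖v − u‖ ≤ ε` along `γ`, then
`circulation u γ − ε L ≤ circulation v γ`. [folklore] -/
theorem circulation_sub_le_of_near {u v : EuclideanSpace ℝ (Fin 3) → EuclideanSpace ℝ (Fin 3)}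
    {γ : ℝ → EuclideanSpace ℝ (Fin 3)} (hu : Continuous u) (hv : Continuous v) (hγ : ContDiff ℝ 1 γ)
    {ε L : ℝ} (hL : ∀ s ∈ Icc (0 : ℝ) 1, ‖deriv γ s‖ ≤ L)
    (hε : ∀ s ∈ Icc (0 : ℝ) 1, ‖v (γ s) - u (γ s)‖ ≤ ε) :
    circulation u γ - ε * L ≤ circulation v γ := by
  unfold circulation
  have hγc : Continuous γ := hγ.continuous
  have hγ' : Continuous (deriv γ) := hγ.continuous_deriv le_rfl
  have hiu : IntervalIntegrable (fun s => ⟪u (γ s), deriv γ s⟫) volume 0 1 :=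
    ((hu.comp hγc).inner hγ').intervalIntegrable _ _
  have hiv : IntervalIntegrable (fun s => ⟪v (γ s), deriv γ s⟫) volume 0 1 :=
    ((hv.comp hγc).inner hγ').intervalIntegrable _ _
  have hdiff : (∫ s in (0 : ℝ)..1, ⟪v (γ s), deriv γ s⟫) - ∫ s in (0 : ℝ)..1, ⟪u (γ s), deriv γ s⟫ =
      ∫ s in (0 : ℝ)..1, ⟪v (γ s) - u (γ s), deriv γ s⟫ := by
    rw [← intervalIntegral.integral_sub hiv hiu]
    congr 1
    funext s
    rw [inner_sub_left]
  have hivu : IntervalIntegrable (fun s => ⟪v (γ s) - u (γ s), deriv γ s⟫) volume 0 1 :=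
    (((hv.comp hγc).sub (hu.comp hγc)).inner hγ').intervalIntegrable _ _
  have hbound : ∫ _ in (0 : ℝ)..1, -(ε * L) ≤ ∫ s in (0 : ℝ)..1, ⟪v (γ s) - u (γ s), deriv γ s⟫ :=
    intervalIntegral.integral_mono_on zero_le_one intervalIntegrable_const hivu fun s hs => by
      have h1 := abs_real_inner_le_norm (v (γ s) - u (γ s)) (deriv γ s)
      have h2 := hε s hs
      have h3 := hL s hs
      have h4 := (abs_le.1 h1).1
      nlinarith [norm_nonneg (v (γ s) - u (γ s)), norm_nonneg (deriv γ s)]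
  rw [intervalIntegral.integral_const] at hbound
  simp only [sub_zero, smul_eq_mul, one_mul] at hbound
  linarith

/-- A lower bound survives a perturbation of controlled size: `a ≤ ‖y‖` and `‖z − y‖ ≤ ε` give
`a − ε ≤ ‖z‖`. [folklore] -/
theorem le_norm_of_near {E : Type*} [SeminormedAddCommGroup E] {y z : E} {a ε : ℝ}
    (ha : a ≤ ‖y‖) (hε : ‖z - y‖ ≤ ε) : a - ε ≤ ‖z‖ := by
  have := norm_sub_norm_le y z
  rw [norm_sub_rev] at hε
  linarith

/-- An upper bound survives a perturbation of controlled size: `‖y‖ ≤ b` and `‖z − y‖ ≤ ε` give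
`‖z‖ ≤ b + ε`. [folklore] -/
theorem norm_le_of_near {E : Type*} [SeminormedAddCommGroup E] {y z : E} {b ε : ℝ}
    (hb : ‖y‖ ≤ b) (hε : ‖z - y‖ ≤ ε) : ‖z‖ ≤ b + ε := by
  have := norm_le_norm_add_norm_sub' z y
  linarith

namespace OrthogonalSeed

/-! ## §2 The certified numbers of the layer with their slack -/

/-- `‖readout(1/120, 0, 0)‖ ≥ 3040` (`‖u‖² = (6500/3)² + V²`, `V ≥ 6400/3`; `3040² ≤ 83210000/9`). [folklore] -/
theorem norm_readout_point_ge : (3040 : ℝ) ≤ ‖readout !₂[(1 : ℝ) / 120, 0, 0]‖ := by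
  obtain ⟨hκ, -⟩ := rate_bounds
  have hs : 1 ≤ burgersLayerRate γc 1 * (1 / 120) := by
    have : (1 : ℝ) ≤ 360.5 * (1 / 120) := by norm_num
    exact this.trans (mul_le_mul_of_nonneg_right hκ (by norm_num))
  have hV : ΔUc / Real.sqrt Real.pi * (2 / 3) ≤ burgersLayerProfile γc 1 ΔUc (1 / 120) :=
    burgersLayerProfile_ge_of_one_le (by norm_num [ΔUc]) hs
  have hV' : (6400 : ℝ) / 3 ≤ burgersLayerProfile γc 1 ΔUc (1 / 120) := by
    refine le_trans ?_ hV
    have hπ : 0 < Real.sqrt Real.pi := Real.sqrt_pos.2 Real.pi_pos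
    rw [ΔUc, div_mul_eq_mul_div, le_div_iff₀ hπ]
    nlinarith [sqrt_pi_le_two]
  have hsq : ‖readout !₂[(1 : ℝ) / 120, 0, 0]‖ ^ 2 =
      γc ^ 2 * ((1 / 120) ^ 2 + 0 ^ 2) + burgersLayerProfile γc 1 ΔUc (1 / 120) ^ 2 := by
    rw [readout, norm_burgersLayer_sq]
    simp
  have hγ : γc ^ 2 * (((1 : ℝ) / 120) ^ 2 + 0 ^ 2) = 42250000 / 9 := by norm_num [γc]
  have h3 : (3040 : ℝ) ^ 2 ≤ ‖readout !₂[(1 : ℝ) / 120, 0, 0]‖ ^ 2 := by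
    rw [hsq, hγ]
    nlinarith [hV', sq_nonneg (burgersLayerProfile γc 1 ΔUc (1 / 120) - 6400 / 3)]
  nlinarith [norm_nonneg (readout !₂[(1 : ℝ) / 120, 0, 0]), h3]

/-- `‖D readout(0)‖ ≥ 1299830` (`V′(0) = 6400·√130000/√π ≥ (6400/1.775)·360.5`). [folklore] -/
theorem norm_fderiv_readout_ge : (1299830 : ℝ) ≤ ‖fderiv ℝ readout 0‖ := by
  obtain ⟨hκ, -⟩ := rate_bounds
  have h := slope_le_norm_fderiv_burgersLayer (γ := γc) (ν := 1) (ΔU := ΔUc)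
    (x := (0 : EuclideanSpace ℝ (Fin 3))) rfl
  have hπ : 0 < Real.sqrt Real.pi := Real.sqrt_pos.2 Real.pi_pos
  have h1 : (6400 : ℝ) / 1.775 ≤ ΔUc / Real.sqrt Real.pi := by
    rw [ΔUc]
    exact div_le_div_of_nonneg_left (by norm_num) hπ sqrt_pi_le
  have h2 : (6400 : ℝ) / 1.775 * 360.5 ≤ ΔUc / Real.sqrt Real.pi * burgersLayerRate γc 1 :=
    mul_le_mul h1 hκ (by norm_num) (le_trans (by norm_num) h1)
  have h3 : (1299830 : ℝ) ≤ 6400 / 1.775 * 360.5 := by norm_num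
  rw [readout]
  linarith

/-- `‖readout x‖ ≤ 4562` on the slab `x₀² + x₂² ≤ (1/80)²` (`‖u‖² ≤ 20802500 ≤ 4562²`). [folklore] -/
theorem norm_readout_slab_le (x : EuclideanSpace ℝ (Fin 3)) (hx : x 0 ^ 2 + x 2 ^ 2 ≤ (1 / 80) ^ 2) :
    ‖readout x‖ ≤ 4562 := by
  have hV := burgersLayerProfile_sq_le (γ := γc) (ν := 1) (ΔU := ΔUc)
    (by norm_num [γc]) one_pos (by norm_num [ΔUc]) (x 0)
  have hc : (ΔUc / 2) ^ 2 = (3200 : ℝ) ^ 2 := by norm_num [ΔUc]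
  rw [hc] at hV
  have hγ : γc ^ 2 = (260000 : ℝ) ^ 2 := by norm_num [γc]
  have hsq := norm_burgersLayer_sq γc 1 ΔUc x
  rw [hγ] at hsq
  have h1 : ‖readout x‖ ^ 2 ≤ 4562 ^ 2 := by
    rw [readout, hsq]
    nlinarith [hx, hV]
  nlinarith [norm_nonneg (readout x), h1]

/-- Circulation of the layer around the core-ledger loop `≥ 13.5` (the quantitative bound
`π(ΔU/√π)κρ²(1 − κ²ρ²/3) ≥ 3·3200·360.5·(1/446)²·0.78 = 13.57…`). [folklore] -/
theorem circulation_readout_ge : (13.5 : ℝ) ≤ circulation readout coreLoop := by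
  refine le_trans ?_ circulation_ge
  obtain ⟨hκ1, hκ2⟩ := rate_bounds
  obtain ⟨hρ1, hρ2⟩ := inv_N_one_bounds
  set ρ : ℝ := 1 / TowerRates.wide.N 1 with hρ
  set κ := burgersLayerRate γc 1 with hκ
  have hπs : 0 < Real.sqrt Real.pi := Real.sqrt_pos.2 Real.pi_pos
  have hD : (3200 : ℝ) ≤ ΔUc / Real.sqrt Real.pi := by
    rw [ΔUc, le_div_iff₀ hπs]; nlinarith [sqrt_pi_le_two]
  have hρ0 : 0 ≤ ρ := le_trans (by norm_num) hρ1
  have hκρ : κ ^ 2 * ρ ^ 2 ≤ 361 ^ 2 * (1 / 445) ^ 2 := by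
    have h1 : κ ^ 2 ≤ 361 ^ 2 := pow_le_pow_left₀ (by linarith) hκ2 2
    have h2 : ρ ^ 2 ≤ (1 / 445) ^ 2 := pow_le_pow_left₀ hρ0 hρ2 2
    exact mul_le_mul h1 h2 (by positivity) (by positivity)
  have hfac : (0.78 : ℝ) ≤ 1 - κ ^ 2 * ρ ^ 2 / 3 := by
    have : (361 : ℝ) ^ 2 * (1 / 445) ^ 2 / 3 ≤ 0.22 := by norm_num
    linarith
  have hρsq : (1 / 446 : ℝ) ^ 2 ≤ ρ ^ 2 := pow_le_pow_left₀ (by norm_num) hρ1 2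
  have hA : (360.5 : ℝ) * (1 / 446) ^ 2 * 0.78 ≤ κ * ρ ^ 2 * (1 - κ ^ 2 * ρ ^ 2 / 3) :=
    mul_le_mul (mul_le_mul hκ1 hρsq (by positivity) (by linarith)) hfac (by norm_num)
      (by positivity)
  have hB : (3200 : ℝ) * (360.5 * (1 / 446) ^ 2 * 0.78) ≤
      ΔUc / Real.sqrt Real.pi * (κ * ρ ^ 2 * (1 - κ ^ 2 * ρ ^ 2 / 3)) :=
    mul_le_mul hD hA (by positivity) (by linarith)
  have hC : (3 : ℝ) * (3200 * (360.5 * (1 / 446) ^ 2 * 0.78)) ≤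
      π * (ΔUc / Real.sqrt Real.pi * (κ * ρ ^ 2 * (1 - κ ^ 2 * ρ ^ 2 / 3))) :=
    mul_le_mul Real.pi_gt_three.le hB (by positivity) Real.pi_pos.le
  have hnum : (13.5 : ℝ) ≤ 3 * (3200 * (360.5 * (1 / 446) ^ 2 * 0.78)) := by norm_num
  linarith

/-- The loop's speed in numbers: `‖γ′(s)‖ = 2π/N₁ ≤ 0.01413`. [folklore] -/
theorem norm_deriv_coreLoop_le_num (s : ℝ) : ‖deriv coreLoop s‖ ≤ 0.01413 := by
  rw [norm_deriv_coreLoop]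
  obtain ⟨hN, -⟩ := TowerRates.wide_N_one_bounds
  rw [div_le_iff₀ (by linarith)]
  linarith [Real.pi_lt_d4]

/-- The readout profile is continuous. [folklore] -/
theorem continuous_readout : Continuous readout := (contDiff_burgersLayer γc 1 ΔUc).continuous

/-! ## §3 The level-1 clauses for a slice NEAR a translated layer -/

/-- **Velocity floor, robust**: any slice within `261` of the layer at the read-out point `c + x⋆`,
`x⋆ = (1/120, 0, 0)`, shows the level-1 floor there: `Y₁ ≤ ‖v(c + x⋆)‖` (`3040 − 261 = 2779 > Y₁`).
[folklore] -/
theorem speedFloor_of_near (v : EuclideanSpace ℝ (Fin 3) → EuclideanSpace ℝ (Fin 3))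
    (c : EuclideanSpace ℝ (Fin 3))
    (h : ‖v (c + !₂[(1 : ℝ) / 120, 0, 0]) - readout !₂[(1 : ℝ) / 120, 0, 0]‖ ≤ 261) :
    TowerRates.wide.Y 1 ≤ ‖v (c + !₂[(1 : ℝ) / 120, 0, 0])‖ := by
  have hY := TowerRates.wide_Y_one_bounds.2
  have := le_norm_of_near norm_readout_point_ge h
  linarith

/-- **Strain floor, robust**: any slice whose derivative at `c` is within `61000` (operator norm) of the
layer's derivative at the origin shows the level-1 gradient floor: `A₁ ≤ ‖Dv(c)‖`
(`1299830 − 61000 ≥ 1238361 > A₁`). [folklore] -/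
theorem strainFloor_of_near (v : EuclideanSpace ℝ (Fin 3) → EuclideanSpace ℝ (Fin 3))
    (c : EuclideanSpace ℝ (Fin 3)) (h : ‖fderiv ℝ v c - fderiv ℝ readout 0‖ ≤ 61000) :
    TowerRates.wide.A 1 ≤ ‖fderiv ℝ v c‖ := by
  have hA := TowerRates.wide_A_one_bounds.2
  have := le_norm_of_near norm_fderiv_readout_ge h
  linarith

/-- **Slab ceiling, robust**: at `c + x`, `x` in the slab `x₀² + x₂² ≤ (1/80)²`, any slice within `68` of
the layer obeys the level-1 ceiling: `‖v(c + x)‖ ≤ (5/3)Y₁` (`4562 + 68 = 4630 < (5/3)Y₁`). [folklore] -/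
theorem slabCeiling_of_near (v : EuclideanSpace ℝ (Fin 3) → EuclideanSpace ℝ (Fin 3))
    (c x : EuclideanSpace ℝ (Fin 3)) (hx : x 0 ^ 2 + x 2 ^ 2 ≤ (1 / 80) ^ 2)
    (h : ‖v (c + x) - readout x‖ ≤ 68) : ‖v (c + x)‖ ≤ 5 / 3 * TowerRates.wide.Y 1 := by
  have hY := TowerRates.wide_Y_one_bounds.1
  have := norm_le_of_near (norm_readout_slab_le x hx) h
  linarith

/-- **Core-ledger floor, robust**: a continuous slice within `500` of the layer along the translated loop
`c + γ_{1/N₁}` carries circulation `≥ N₁^{β−2}` around it (`13.5 − 500·0.01413 ≥ 6.43 > 6.234 > N₁^{β−2}`).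
[folklore] -/
theorem coreFloor_of_near {v : EuclideanSpace ℝ (Fin 3) → EuclideanSpace ℝ (Fin 3)} (hv : Continuous v)
    (c : EuclideanSpace ℝ (Fin 3)) (h : ∀ s ∈ Icc (0 : ℝ) 1, ‖v (c + coreLoop s) - readout (coreLoop s)‖ ≤ 500) :
    TowerRates.wide.N 1 ^ (TowerRates.wide.β - 2) ≤ circulation v (fun s => c + coreLoop s) := by
  rw [circulation_translate]
  have hN := TowerRates.wide_N_one_rpow_bounds.2
  have hvc : Continuous fun y : EuclideanSpace ℝ (Fin 3) => v (c + y) := hv.comp (continuous_const.add continuous_id)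
  have hmain := circulation_sub_le_of_near (γ := coreLoop) (ε := 500) (L := 0.01413) continuous_readout hvc
    contDiff_coreLoop (fun s _ => norm_deriv_coreLoop_le_num s) h
  have h13 := circulation_readout_ge
  have : (6.234 : ℝ) ≤ 13.5 - 500 * 0.01413 := by norm_num
  linarith

/-- **The three pointed clauses at once, for a slice near a translated layer.** On a rigid wide schedule
whose ball contains the read-out points (`‖c‖ + 1/120 ≤ radius`), a continuous slice `v` that is within
`261` of the layer at `c + x⋆`, within `61000` in derivative at `c`, and within `500` along the loop
`c + γ_{1/N₁}` satisfies the `j = 1` clauses of `Stage.floor`, `Margins.withStrain` and `CoreLedger` with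
`u (τ 1)` replaced by `v`; the slab ceiling is `slabCeiling_of_near` pointwise. [folklore] -/
theorem clauses_of_near (S : Schedule TowerRates.wide) (hS : S.Rigid)
    {v : EuclideanSpace ℝ (Fin 3) → EuclideanSpace ℝ (Fin 3)} (hv : Continuous v)
    (c : EuclideanSpace ℝ (Fin 3)) (hc : ‖c‖ + 1 / 120 ≤ S.radius)
    (h₁ : ‖v (c + !₂[(1 : ℝ) / 120, 0, 0]) - readout !₂[(1 : ℝ) / 120, 0, 0]‖ ≤ 261)
    (h₂ : ‖fderiv ℝ v c - fderiv ℝ readout 0‖ ≤ 61000)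
    (h₃ : ∀ s ∈ Icc (0 : ℝ) 1, ‖v (c + coreLoop s) - readout (coreLoop s)‖ ≤ 500) :
    (∃ x : EuclideanSpace ℝ (Fin 3), ‖x‖ ≤ S.radius ∧ S.c₁ * TowerRates.wide.Y 1 ≤ ‖v x‖) ∧
    (∃ x : EuclideanSpace ℝ (Fin 3), ‖x‖ ≤ S.radius ∧ S.c₁ * TowerRates.wide.A 1 ≤ ‖fderiv ℝ v x‖) ∧
    (∃ (x : EuclideanSpace ℝ (Fin 3)) (γ : ℝ → EuclideanSpace ℝ (Fin 3)),
      ‖x‖ ≤ S.radius ∧ ContDiff ℝ 1 γ ∧ γ 0 = γ 1 ∧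
      (∀ s ∈ Icc (0 : ℝ) 1, γ s ∈ Metric.closedBall x (1 / TowerRates.wide.N 1)) ∧
      (∀ s ∈ Icc (0 : ℝ) 1, ‖deriv γ s‖ ≤ 8 * π / TowerRates.wide.N 1) ∧
      S.c₁ * TowerRates.wide.N 1 ^ (TowerRates.wide.β - 2) ≤ circulation v γ) := by
  have hc0 : ‖c‖ ≤ S.radius := by linarith [show (0 : ℝ) ≤ 1 / 120 by norm_num]
  refine ⟨⟨c + !₂[(1 : ℝ) / 120, 0, 0], ?_, by rw [hS.c₁_eq, one_mul]; exact speedFloor_of_near v c h₁⟩,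
    ⟨c, hc0, by rw [hS.c₁_eq, one_mul]; exact strainFloor_of_near v c h₂⟩,
    ⟨c, fun s => c + coreLoop s, hc0, contDiff_const.add contDiff_coreLoop, by simp [coreLoop_closed],
      fun s _ => ?_, fun s _ => ?_, by rw [hS.c₁_eq, one_mul]; exact coreFloor_of_near hv c h₃⟩⟩
  · have hx : ‖(!₂[(1 : ℝ) / 120, 0, 0] : EuclideanSpace ℝ (Fin 3))‖ = 1 / 120 :=
      (sq_eq_sq₀ (norm_nonneg _) (by norm_num)).1 (by rw [norm_vec_sq]; ring)
    exact (norm_add_le _ _).trans (by rw [hx]; exact hc)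
  · rw [Metric.mem_closedBall, dist_eq_norm, add_sub_cancel_left, norm_coreLoop]
  · rw [deriv_const_add]; exact norm_deriv_coreLoop_le s

end OrthogonalSeed

end Summit.NavierStokesRegularity.FluidComputer.PalasekTowerClayBridge

end
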